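import Literature.Analysis.FluidPDE.NormalisedPressureAffine
import Literature.Analysis.FluidPDE.ClassicalSolutionRescale
import HarnessLib

/-!
# Navier–Stokes scaling of the pointwise Navier–Stokes inequality

Analysis/FluidPDE support file (serves the discharge of the barrier fact
`Literature.Barriers.NavierStokesRegularity.NSISwitching`: Scheffer 1985, Lemma 2.3 /
Ożański 2017, §2, where the rescaled copies `u^{(j)}(x,t) = τ^{-j}u(Γ^{-j}x, τ^{-2j}(t - t_j))`
of a classical solution of the Navier–Stokes inequality (NSI) must again "satisfy the
Navier–Stokes inequality (2.1) on `ℝ³ × [T, (1+τ²)T]`", Ożański p. 6).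

For the parabolic pull-back `w = γ • stPull γ² γ t₀ x₀ u`, i.e.
`w(t, x) = γ u(t₀ + γ²t, x₀ + γx)` (amplitude `γ`, time dilation `γ²`, space dilation `γ`, the
Navier–Stokes scaling; accepted `FluidPDE/SpaceTimeRescaling`, `ClassicalSolutionRescale`), with
the pressure function of a slice taken to be the normalised pressure `p̃[·]` of the accepted
`NormalisedPressure` (covariant by `normalisedPressure_smul_comp_affine`):

* `normSq_smul_stPull`, `normalisedPressure_smul_stPull_slice`, `fderiv_smul_stPull_slice`,
  `laplacian_smul_stPull_slice` — the scaling of `|w|²`, `p̃[w(t)]`, `∇w`, `Δw`;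
* `nsi_smul_stPull` — **scale covariance of the pointwise NSI**: if
  `∂ₜ|u|² ≤ -u·∇(|u|² + 2p̃[u]) + 2ν u·Δu` at `(t₀ + γ²t, x₀ + γx)` then the same inequality holds
  for `w` at `(t, x)` (all three terms scale by `γ⁴`).

## References

* W. S. Ożański, *On weak solutions to the Navier–Stokes inequality with internal
  singularities*, arXiv:1709.00602 (2017), §2, (2.1) and the sentence after (2.4).
  [`Ozanski2017NSISingular`]
* V. Scheffer, Comm. Math. Phys. 101 (1985), proof of Lemma 2.3, p. 56 (the rescaled
  `u^{j+1}, p^{j+1}`). [`Scheffer1985`]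
-/

noncomputable section

open MeasureTheory Set Function Filter Topology InnerProductSpace
open scoped InnerProductSpace RealInnerProductSpace ContDiff Laplacian

namespace Literature.Analysis.FluidPDE

variable {E : Type*} [NormedAddCommGroup E] [InnerProductSpace ℝ E] [FiniteDimensional ℝ E]
  [MeasurableSpace E] [BorelSpace E]

/-! ### Elementary scaling rules -/

section Rules

variable {X : Type*} [NormedAddCommGroup X] [NormedSpace ℝ X]

omit [MeasurableSpace E] [BorelSpace E] [InnerProductSpace ℝ E] [FiniteDimensional ℝ E] in
/-- The time derivative commutes with constant factors (unconditionally, both sides being junk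
`0` together; Mathlib `deriv_const_mul_field`). [folklore] -/
theorem timeDeriv_const_mul [NormedSpace ℝ E] (c : ℝ) (g : ℝ → E → ℝ) (t : ℝ) (x : E) :
    timeDeriv (fun s y => c * g s y) t x = c * timeDeriv g t x := by
  simp only [timeDeriv_apply]
  exact deriv_const_mul_field c

omit [MeasurableSpace E] [BorelSpace E] [FiniteDimensional ℝ E] in
/-- `|α u ∘ Φ|² = α² |u|² ∘ Φ` as space–time fields. [folklore] -/
theorem normSq_smul_stPull (α β γ t₀ : ℝ) (x₀ : E) (u : ℝ → E → X) :
    (fun s y => ‖(α • stPull β γ t₀ x₀ u) s y‖ ^ 2) =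
      fun s y => α ^ 2 * stPull β γ t₀ x₀ (fun t x => ‖u t x‖ ^ 2) s y := by
  funext s y
  simp only [Pi.smul_apply, stPull_apply, norm_smul, mul_pow, Real.norm_eq_abs, sq_abs]

omit [MeasurableSpace E] [BorelSpace E] [FiniteDimensional ℝ E] in
/-- The time derivative of `|α u ∘ Φ|²`: `∂ₛ|w|²(s, y) = α²β ∂ₜ|u|²(Φ(s, y))`. [folklore] -/
theorem timeDeriv_normSq_smul_stPull (α β γ t₀ : ℝ) (x₀ : E) (u : ℝ → E → X) (s : ℝ) (y : E) :
    timeDeriv (fun s y => ‖(α • stPull β γ t₀ x₀ u) s y‖ ^ 2) s y =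
      α ^ 2 * β * timeDeriv (fun t x => ‖u t x‖ ^ 2) (t₀ + β * s) (x₀ + γ • y) := by
  rw [normSq_smul_stPull, timeDeriv_const_mul, timeDeriv_stPull, smul_eq_mul, mul_assoc]

/-- **The pressure function of a rescaled slice**: `p̃[w(s)] = α² p̃[u(t₀ + βs)] ∘ (x₀ + γ·)`
for `w = α • stPull β γ t₀ x₀ u`, `γ > 0` (accepted `normalisedPressure_smul_comp_affine`).
[cite: Ozanski2017NSISingular, §2 (2.4)] -/
theorem normalisedPressure_smul_stPull_slice (α β : ℝ) {γ : ℝ} (hγ : 0 < γ) (t₀ : ℝ) (x₀ : E)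
    (u : ℝ → E → E) (s : ℝ) :
    normalisedPressure ((α • stPull β γ t₀ x₀ u) s) =
      fun y => α ^ 2 * normalisedPressure (u (t₀ + β * s)) (x₀ + γ • y) := by
  funext y
  rw [smul_stPull_slice]
  exact normalisedPressure_smul_comp_affine (u (t₀ + β * s)) x₀ α hγ y

omit [MeasurableSpace E] [BorelSpace E] [FiniteDimensional ℝ E] in
/-- The slice derivative of a rescaled field: `D(w s)(y) = αγ D(u t)(x)` at `(t,x) = Φ(s,y)`,
for a differentiable slice. [folklore] -/
theorem fderiv_smul_stPull_slice {α β γ t₀ : ℝ} {x₀ : E} {u : ℝ → E → X} {s : ℝ}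
    (h : Differentiable ℝ (u (t₀ + β * s))) (y : E) :
    fderiv ℝ ((α • stPull β γ t₀ x₀ u) s) y = (α * γ) • fderiv ℝ (u (t₀ + β * s)) (x₀ + γ • y) := by
  have hd : DifferentiableAt ℝ (stPull β γ t₀ x₀ u s) y := differentiable_stPull_slice h y
  rw [show (α • stPull β γ t₀ x₀ u) s = fun y => α • stPull β γ t₀ x₀ u s y from rfl,
    fderiv_fun_const_smul hd, fderiv_stPull, smul_smul]

omit [MeasurableSpace E] [BorelSpace E] in
/-- The slice Laplacian of a rescaled field: `Δ(w s)(y) = αγ² Δ(u t)(x)` at `(t,x) = Φ(s,y)`, for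
a `C²` slice. [folklore] -/
theorem laplacian_smul_stPull_slice {α β γ t₀ : ℝ} {x₀ : E} {u : ℝ → E → X} {s : ℝ}
    (h : ContDiff ℝ 2 (u (t₀ + β * s))) (y : E) :
    Δ ((α • stPull β γ t₀ x₀ u) s) y = (α * γ ^ 2) • Δ (u (t₀ + β * s)) (x₀ + γ • y) := by
  have h2 : ContDiff ℝ 2 (stPull β γ t₀ x₀ u s) := contDiff_stPull_slice h
  rw [show (α • stPull β γ t₀ x₀ u) s = α • stPull β γ t₀ x₀ u s from rfl,
    InnerProductSpace.laplacian_smul α h2.contDiffAt, laplacian_stPull β γ t₀ x₀ u s y h,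
    smul_smul]

end Rules

/-! ### Scale covariance of the pointwise Navier–Stokes inequality -/

section NSI

variable {u : ℝ → E → E} {γ t₀ ν t : ℝ} {x₀ x : E}

/-- **The pointwise Navier–Stokes inequality is invariant under the Navier–Stokes scaling.**
Let `w = γ • stPull γ² γ t₀ x₀ u`, i.e. `w(t, x) = γ u(t₀ + γ²t, x₀ + γx)`, `γ > 0`, and let the
pressure functions be the normalised pressures of the slices. If at `(s, y) = (t₀ + γ²t, x₀ + γx)`
the slice `u(s)` is `C²`, `|u(s)|² + 2p̃[u(s)]` is differentiable at `y`, and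
`∂ₜ|u|² ≤ -u·∇(|u|² + 2p̃[u]) + 2ν u·Δu` holds at `(s, y)`, then the same inequality holds for
`w` at `(t, x)`: each of the three terms is multiplied by `γ⁴` (Ożański 2017, §2: "`u^{(1)}`
satisfies the Navier–Stokes inequality (2.1)"). [cite: Ozanski2017NSISingular, §2 (2.1)–(2.4)] -/
theorem nsi_smul_stPull (hγ : 0 < γ) (hu2 : ContDiff ℝ 2 (u (t₀ + γ ^ 2 * t)))
    (hg : DifferentiableAt ℝ (fun y => ‖u (t₀ + γ ^ 2 * t) y‖ ^ 2 +
      2 * normalisedPressure (u (t₀ + γ ^ 2 * t)) y) (x₀ + γ • x))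
    (hnsi : timeDeriv (fun s y => ‖u s y‖ ^ 2) (t₀ + γ ^ 2 * t) (x₀ + γ • x) ≤
      -⟪u (t₀ + γ ^ 2 * t) (x₀ + γ • x), gradient (fun y => ‖u (t₀ + γ ^ 2 * t) y‖ ^ 2 +
        2 * normalisedPressure (u (t₀ + γ ^ 2 * t)) y) (x₀ + γ • x)⟫ +
      2 * ν * ⟪u (t₀ + γ ^ 2 * t) (x₀ + γ • x), Δ (u (t₀ + γ ^ 2 * t)) (x₀ + γ • x)⟫) :
    timeDeriv (fun s y => ‖(γ • stPull (γ ^ 2) γ t₀ x₀ u) s y‖ ^ 2) t x ≤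
      -⟪(γ • stPull (γ ^ 2) γ t₀ x₀ u) t x,
          gradient (fun y => ‖(γ • stPull (γ ^ 2) γ t₀ x₀ u) t y‖ ^ 2 +
            2 * normalisedPressure ((γ • stPull (γ ^ 2) γ t₀ x₀ u) t) y) x⟫ +
      2 * ν * ⟪(γ • stPull (γ ^ 2) γ t₀ x₀ u) t x, Δ ((γ • stPull (γ ^ 2) γ t₀ x₀ u) t) x⟫ := by
  haveI : CompleteSpace E := FiniteDimensional.complete ℝ E
  set s : ℝ := t₀ + γ ^ 2 * t with hs
  set y : E := x₀ + γ • x with hy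
  -- the scalar field `Θ = |u|² + 2p̃[u]` and its pull-back
  set Θ : ℝ → E → ℝ := fun s' y' => ‖u s' y'‖ ^ 2 + 2 * normalisedPressure (u s') y' with hΘ
  have hθw : (fun y' => ‖(γ • stPull (γ ^ 2) γ t₀ x₀ u) t y'‖ ^ 2 +
      2 * normalisedPressure ((γ • stPull (γ ^ 2) γ t₀ x₀ u) t) y') =
      fun y' => γ ^ 2 • stPull (γ ^ 2) γ t₀ x₀ Θ t y' := by
    funext y'
    rw [normalisedPressure_smul_stPull_slice γ (γ ^ 2) hγ t₀ x₀ u t]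
    simp only [Pi.smul_apply, stPull_apply, norm_smul, mul_pow, Real.norm_eq_abs, sq_abs, hΘ,
      smul_eq_mul]
    ring
  -- (1) the time derivative scales by `γ⁴`
  have h1 : timeDeriv (fun s y => ‖(γ • stPull (γ ^ 2) γ t₀ x₀ u) s y‖ ^ 2) t x =
      γ ^ 4 * timeDeriv (fun t x => ‖u t x‖ ^ 2) s y := by
    rw [timeDeriv_normSq_smul_stPull]
    ring
  -- (2) the transport/pressure term scales by `γ⁴`
  have hΘd : DifferentiableAt ℝ (stPull (γ ^ 2) γ t₀ x₀ Θ t) x := by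
    have : stPull (γ ^ 2) γ t₀ x₀ Θ t = fun y' => Θ s (x₀ + γ • y') := rfl
    rw [this]
    exact hg.comp x ((differentiableAt_const _).add (differentiableAt_id.const_smul γ))
  have h2 : ⟪(γ • stPull (γ ^ 2) γ t₀ x₀ u) t x,
      gradient (fun y' => ‖(γ • stPull (γ ^ 2) γ t₀ x₀ u) t y'‖ ^ 2 +
        2 * normalisedPressure ((γ • stPull (γ ^ 2) γ t₀ x₀ u) t) y') x⟫ =
      γ ^ 4 * ⟪u s y, gradient (Θ s) y⟫ := by
    rw [hθw, gradient_const_smul hΘd, gradient_stPull]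
    simp only [Pi.smul_apply, stPull_apply, inner_smul_left, inner_smul_right, RCLike.conj_to_real]
    ring
  -- (3) the viscous term scales by `γ⁴`
  have h3 : ⟪(γ • stPull (γ ^ 2) γ t₀ x₀ u) t x, Δ ((γ • stPull (γ ^ 2) γ t₀ x₀ u) t) x⟫ =
      γ ^ 4 * ⟪u s y, Δ (u s) y⟫ := by
    rw [laplacian_smul_stPull_slice hu2]
    simp only [Pi.smul_apply, stPull_apply, inner_smul_left, inner_smul_right, RCLike.conj_to_real]
    ring
  rw [h1, h2, h3]
  have hγ4 : 0 < γ ^ 4 := pow_pos hγ 4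
  have key := mul_le_mul_of_nonneg_left hnsi hγ4.le
  have e : γ ^ 4 * (-⟪u s y, gradient (Θ s) y⟫ + 2 * ν * ⟪u s y, Δ (u s) y⟫) =
      -(γ ^ 4 * ⟪u s y, gradient (Θ s) y⟫) + 2 * ν * (γ ^ 4 * ⟪u s y, Δ (u s) y⟫) := by ring
  rw [e] at key
  exact key

end NSI

end Literature.Analysis.FluidPDE

end
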